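import Literature.Analysis.FluidPDE.LocalLerayCylinderSliceNorms
import Literature.Analysis.FunctionSpaces.DoubledPairingLimit
import HarnessLib

/-!
# The doubled pairings of the `u₁ · u₂` balance of two local Leray solutions

Analysis/FluidPDE theorem file (no definitions). In the proof of weak–strong uniqueness for local
Leray solutions (Lemarié-Rieusset 2016, Thm. 14.7, p. 515) the balance equation for `u₁ · u₂` is
obtained by testing each solution's equation with (a cut-off `ψ` times a time slice of) the other
solution and doubling the time variable (Serrin 1963, §4; the accepted
`FunctionSpaces.doubling_identity_compact`). Passing to the limit in the doubling requires, for
each bulk term, the convergence of a doubled pairing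
`∫∫ ρₙ(s-σ) ∫_K ⟪a(s,x), b(σ,x)⟫ → ∫ ∫_K ⟪a(s,x), b(s,x)⟫` in the mixed Lebesgue norms in which
the factors live (the accepted `FunctionSpaces.doubledPairing_package_of_ae_le` / `_of_rpow`).
This file verifies the hypotheses of those packages for the nine atomic pairings of the argument,
for two local Leray solutions `(u₁, p₁)`, `(u₂, p₂)` on `(0,T) × ℝ³` with weak gradients
`G₁, G₂`, the first of which is *regular* in the sense of Thm. 14.7: `u₁ = u₃ + u₄` with
`‖u₃(t)‖_∞ ≤ m(t)`, `m ∈ L²(0,T)`, and `‖u₄(t)‖_{L³} ≤ ε`: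

| pairing | `a(s,x)` | `b(σ,x)` | spaces |
|---|---|---|---|
| 1 | `χ(s)ψ(x) G₁(u₃)` | `u₂` | `L¹L² × L^∞L²` |
| 2 | `χψ G₁(u₁-u₃)` | `u₂` | `L²L^{6/5} × L²L⁶` |
| 3 | `χ p₁ ∇ψ` | `u₂` | `L^{3/2}L^{3/2} × L³L³` |
| 4 | `χ G₁(∇ψ)` | `u₂` | `L²L² × L²L²` |
| 5ᵢ | `χψ G₁eᵢ` | `G₂eᵢ` | `L²L² × L²L²` |
| 6 | `θ G₂(u₂)` | `χψ u₃` | `L²L¹ × L²L^∞` |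
| 7 | `θ G₂(u₂)` | `χψ (u₁-u₃)` | `L¹L^{3/2} × L^∞L³` |
| 8 | `χ u₁` | `p₂ ∇ψ` | `L³L³ × L^{3/2}L^{3/2}` |
| 9 | `χ u₁` | `G₂(∇ψ)` | `L²L² × L²L²` |

(`χ` a continuous cut-off in time supported in `[δ, T-δ]`, `θ ≡ 1` on `[δ/2, T-δ/2]`; pairings
6–7 are the swapped forms, `doubledPairing_swap`, `doubledPairing_insert_cutoff`, of the term
`⟪G₂(u₂), ψ u₁⟫` whose `u₁`-factor is only `L²_t L^∞_x + L^∞_t L³_x`).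

## Mathlib / tree search

Tree: `LocalLerayCylinderSliceNorms` (all slice norms), `DoubledPairingLimit` (packages),
`TimeMollification` (`normed_sub_comm`), `aestronglyMeasurable_clm_apply_fin3`
(`NSWeakProductRule`). Mathlib: `integral_prod_swap`, `ENNReal.lintegral_mul_le_Lp_mul_Lq`,
`eLpNorm_le_eLpNorm_mul_rpow_measure_univ`, `Real.HolderTriple.ennrealOfReal`.

## References

* P. G. Lemarié-Rieusset, *The Navier–Stokes Problem in the 21st Century*, CRC Press 2016,
  doi:10.1201/b19556, Thm. 14.7, proof p. 515 (the balance of `u₁ · u₂`). [LemarieRieusset2016]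
* J. Serrin, in: Nonlinear Problems (Madison 1962), 1963, §4. [Serrin1963]
-/

noncomputable section

open MeasureTheory TopologicalSpace Set Function Filter Metric
open _root_.Topology
open scoped ENNReal NNReal RealInnerProductSpace

namespace Literature.Analysis.FluidPDE

open FunctionSpaces

/-! ## Generic manipulations of doubled pairings -/

section Generic

variable {X : Type*} [MeasurableSpace X]
variable {V : Type*} [NormedAddCommGroup V] [InnerProductSpace ℝ V]

/-- **Symmetry of the doubled pairing** (the kernel is even and `(σ,s) ↦ (s,σ)` preserves the
product measure): the roles of the two factors may be exchanged. [folklore] -/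
theorem doubledPairing_swap (φ : ContDiffBump (0 : ℝ)) (T : ℝ) (κ : Measure X) (A B : ℝ → X → V) :
    ∫ pr, φ.normed volume (pr.2 - pr.1) * ∫ x, ⟪A pr.2 x, B pr.1 x⟫ ∂κ
        ∂(((volume : Measure ℝ).restrict (Ioo 0 T)).prod ((volume : Measure ℝ).restrict (Ioo 0 T))) =
      ∫ pr, φ.normed volume (pr.2 - pr.1) * ∫ x, ⟪B pr.2 x, A pr.1 x⟫ ∂κ
        ∂(((volume : Measure ℝ).restrict (Ioo 0 T)).prod ((volume : Measure ℝ).restrict (Ioo 0 T))) := by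
  rw [← integral_prod_swap]
  refine integral_congr_ae (Eventually.of_forall fun pr => ?_)
  simp only [Prod.fst_swap, Prod.snd_swap]
  rw [normed_sub_comm φ pr.1 pr.2]
  congr 1
  exact integral_congr_ae (Eventually.of_forall fun x => real_inner_comm _ _)

/-- **Inserting a time cut-off on the first factor**: if the second factor carries a cut-off `χ`
supported in `[δ, T-δ]`, the kernel has radius `< δ/2`, and `θ ≡ 1` on `[δ/2, T-δ/2]`, then the
doubled integrand is unchanged by multiplying the first factor by `θ`. [folklore] -/
theorem doubledPairing_insert_cutoff (φ : ContDiffBump (0 : ℝ)) {T δ : ℝ} (hφ : φ.rOut < δ / 2)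
    {θ χ : ℝ → ℝ} (hθ : ∀ s ∈ Icc (δ / 2) (T - δ / 2), θ s = 1)
    (hχ : ∀ s, s ∉ Icc δ (T - δ) → χ s = 0) (κ : Measure X) (A B : ℝ → X → V) :
    ∫ pr, φ.normed volume (pr.2 - pr.1) * ∫ x, ⟪A pr.2 x, χ pr.1 • B pr.1 x⟫ ∂κ
        ∂(((volume : Measure ℝ).restrict (Ioo 0 T)).prod ((volume : Measure ℝ).restrict (Ioo 0 T))) =
      ∫ pr, φ.normed volume (pr.2 - pr.1) * ∫ x, ⟪θ pr.2 • A pr.2 x, χ pr.1 • B pr.1 x⟫ ∂κ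
        ∂(((volume : Measure ℝ).restrict (Ioo 0 T)).prod ((volume : Measure ℝ).restrict (Ioo 0 T))) := by
  refine integral_congr_ae (Eventually.of_forall fun pr => ?_)
  by_cases h0 : φ.normed volume (pr.2 - pr.1) = 0
  · simp only [h0, zero_mul]
  by_cases hχ0 : χ pr.1 = 0
  · simp only [hχ0, zero_smul, inner_zero_right]
  · have h1 : |pr.2 - pr.1| < φ.rOut := abs_sub_lt_rOut_of_normed_ne_zero φ h0
    have h2 : pr.1 ∈ Icc δ (T - δ) := by
      by_contra h; exact hχ0 (hχ _ h)
    have hlt := abs_lt.1 (h1.trans hφ)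
    have h3 : pr.2 ∈ Icc (δ / 2) (T - δ / 2) := ⟨by linarith [h2.1, hlt.1], by linarith [h2.2, hlt.2]⟩
    simp only [hθ _ h3, one_smul]

end Generic

/-! ## The setting: two local Leray solutions, the first one regular -/

section Pairings

variable {T ν : ℝ} {u₀ : EuclideanSpace ℝ (Fin 3) → EuclideanSpace ℝ (Fin 3)}
  {u₁ u₂ u₃ u₄ : ℝ → EuclideanSpace ℝ (Fin 3) → EuclideanSpace ℝ (Fin 3)}
  {p₁ p₂ : ℝ → EuclideanSpace ℝ (Fin 3) → ℝ}
  {G₁ G₂ : ℝ → EuclideanSpace ℝ (Fin 3) → EuclideanSpace ℝ (Fin 3) →L[ℝ] EuclideanSpace ℝ (Fin 3)}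
  {m : ℝ → ℝ} {ε : ℝ} {ψ : EuclideanSpace ℝ (Fin 3) → ℝ} {χ θ : ℝ → ℝ} {δ Cχ Cθ : ℝ}
  {φ : ℕ → ContDiffBump (0 : ℝ)}

/-! ### Field facts on the cylinder `(0,T) × supp ψ` -/

/-- A test function and its support: `K = tsupport ψ` is compact, `ψ` and `∇ψ` are bounded and
vanish off `K`. [folklore] -/
theorem testFunction_facts (hψ : IsTestFunctionOn (⊤ : Opens (EuclideanSpace ℝ (Fin 3))) ψ) :
    IsCompact (tsupport ψ) ∧ Continuous ψ ∧ Continuous (gradient ψ) ∧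
      (∃ Cψ : ℝ, 0 ≤ Cψ ∧ (∀ x, ‖ψ x‖ ≤ Cψ) ∧ ∀ x, ‖gradient ψ x‖ ≤ Cψ) ∧
      (∀ x, x ∉ tsupport ψ → ψ x = 0) ∧ (∀ x, x ∉ tsupport ψ → gradient ψ x = 0) := by
  have hc : Continuous ψ := hψ.contDiff.continuous
  have hD : Continuous (fderiv ℝ ψ) := hψ.contDiff.continuous_fderiv (by simp)
  have hg : Continuous (gradient ψ) := by
    unfold gradient
    exact (InnerProductSpace.toDual ℝ (EuclideanSpace ℝ (Fin 3))).symm.continuous.comp hD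
  obtain ⟨C₁, hC₁⟩ := hc.bounded_above_of_compact_support hψ.hasCompactSupport
  have hgK : HasCompactSupport (gradient ψ) :=
    (hψ.hasCompactSupport.fderiv (𝕜 := ℝ)).comp_left
      (g := fun L : EuclideanSpace ℝ (Fin 3) →L[ℝ] ℝ =>
        (InnerProductSpace.toDual ℝ (EuclideanSpace ℝ (Fin 3))).symm L) (by simp)
  obtain ⟨C₂, hC₂⟩ := hg.bounded_above_of_compact_support hgK
  refine ⟨hψ.hasCompactSupport, hc, hg, ⟨max C₁ C₂, (norm_nonneg _).trans ((hC₁ 0).trans (le_max_left _ _)),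
    fun x => (hC₁ x).trans (le_max_left _ _), fun x => (hC₂ x).trans (le_max_right _ _)⟩,
    fun x hx => image_eq_zero_of_notMem_tsupport hx, fun x hx => ?_⟩
  simp [gradient, fderiv_of_notMem_tsupport ℝ hx]

/-! ### Shared sub-lemmas -/

/-- On a finite product measure, a field with `∫ ‖f(s,·)‖²_{L²} ds < ∞` is integrable. [folklore] -/
theorem integrable_of_lintegral_eLpNorm_slice_two {W : Type*} [NormedAddCommGroup W]
    {K : Set (EuclideanSpace ℝ (Fin 3))} (hK : IsCompact K) {f : ℝ → EuclideanSpace ℝ (Fin 3) → W}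
    (hf : AEStronglyMeasurable (uncurry f)
      (((volume : Measure ℝ).restrict (Ioo 0 T)).prod ((volume : Measure (EuclideanSpace ℝ (Fin 3))).restrict K)))
    (h2 : ∫⁻ s, eLpNorm (f s) 2 ((volume : Measure (EuclideanSpace ℝ (Fin 3))).restrict K) ^ (2 : ℝ)
      ∂((volume : Measure ℝ).restrict (Ioo 0 T)) ≠ ∞) :
    Integrable (uncurry f)
      (((volume : Measure ℝ).restrict (Ioo 0 T)).prod ((volume : Measure (EuclideanSpace ℝ (Fin 3))).restrict K)) := by
  haveI : IsFiniteMeasure ((volume : Measure (EuclideanSpace ℝ (Fin 3))).restrict K) :=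
    isFiniteMeasure_restrict.2 hK.measure_lt_top.ne
  haveI : IsFiniteMeasure ((volume : Measure ℝ).restrict (Ioo 0 T)) := inferInstance
  refine MemLp.integrable one_le_two ⟨hf, ?_⟩
  have h1 := lintegral_eLpNorm_slice_rpow_eq hf two_ne_zero ENNReal.ofNat_ne_top
  rw [ENNReal.toReal_ofNat] at h1
  rw [eLpNorm_eq_lintegral_rpow_enorm_toReal two_ne_zero ENNReal.ofNat_ne_top, ENNReal.toReal_ofNat, ← h1]
  exact ENNReal.rpow_lt_top_of_nonneg (by norm_num) h2

/-- The rough part `u₁ - u₃` is integrable on `(0,T) × K` when its slices are bounded in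
`L³(K)` (`L³(K) ⊂ L¹(K)` with constant `|K|^{2/3}`, Tonelli). [folklore] -/
theorem integrable_sub_of_ae_eLpNorm_three_le {K : Set (EuclideanSpace ℝ (Fin 3))} (hK : IsCompact K)
    {u₁ u₃ : ℝ → EuclideanSpace ℝ (Fin 3) → EuclideanSpace ℝ (Fin 3)}
    (hu₁ : AEStronglyMeasurable (uncurry u₁)
      (((volume : Measure ℝ).restrict (Ioo 0 T)).prod ((volume : Measure (EuclideanSpace ℝ (Fin 3))).restrict K)))
    (hu₃ : AEStronglyMeasurable (uncurry u₃)
      (((volume : Measure ℝ).restrict (Ioo 0 T)).prod ((volume : Measure (EuclideanSpace ℝ (Fin 3))).restrict K)))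
    {ε : ℝ} (hε3 : ∀ᵐ t ∂((volume : Measure ℝ).restrict (Ioo 0 T)),
      eLpNorm (fun x => u₁ t x - u₃ t x) 3 ((volume : Measure (EuclideanSpace ℝ (Fin 3))).restrict K) ≤ ENNReal.ofReal ε) :
    Integrable (uncurry fun t x => u₁ t x - u₃ t x)
      (((volume : Measure ℝ).restrict (Ioo 0 T)).prod ((volume : Measure (EuclideanSpace ℝ (Fin 3))).restrict K)) := by
  set μI : Measure ℝ := volume.restrict (Ioo 0 T) with hμI
  set μK : Measure (EuclideanSpace ℝ (Fin 3)) := volume.restrict K with hμK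
  haveI : IsFiniteMeasure μK := isFiniteMeasure_restrict.2 hK.measure_lt_top.ne
  haveI : IsFiniteMeasure μI := by rw [hμI]; infer_instance
  have hm : AEStronglyMeasurable (uncurry fun t x => u₁ t x - u₃ t x) (μI.prod μK) := hu₁.sub hu₃
  refine ⟨hm, ?_⟩
  rw [hasFiniteIntegral_iff_enorm]
  have hslice : ∀ᵐ t ∂μI, ∫⁻ x, ‖u₁ t x - u₃ t x‖ₑ ∂μK ≤
      ENNReal.ofReal ε * μK univ ^ (1 - 1 / (3 : ℝ)) := by
    filter_upwards [hε3, hm.prodMk_left] with t ht hmt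
    have h1 := eLpNorm_le_eLpNorm_mul_rpow_measure_univ (p := 1) (q := 3) (by norm_num) hmt
    rw [eLpNorm_one_eq_lintegral_enorm, ENNReal.toReal_one, ENNReal.toReal_ofNat, div_one] at h1
    exact h1.trans (mul_le_mul' ht le_rfl)
  calc ∫⁻ z, ‖uncurry (fun t x => u₁ t x - u₃ t x) z‖ₑ ∂(μI.prod μK)
      ≤ ∫⁻ t, ∫⁻ x, ‖u₁ t x - u₃ t x‖ₑ ∂μK ∂μI := lintegral_prod_le _
    _ ≤ ∫⁻ t, ENNReal.ofReal ε * μK univ ^ (1 - 1 / (3 : ℝ)) ∂μI := lintegral_mono_ae hslice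
    _ < ∞ := by
        rw [lintegral_const]
        refine ENNReal.mul_lt_top (ENNReal.mul_lt_top ENNReal.ofReal_lt_top ?_) (measure_lt_top _ _)
        exact ENNReal.rpow_lt_top_of_nonneg (by norm_num) (measure_ne_top _ _)

/-- Cauchy–Schwarz in time: `∫ F G ≤ (∫ F²)^{1/2} (∫ G²)^{1/2} < ∞`. [folklore] -/
theorem lintegral_mul_ne_top_of_sq {α : Type*} [MeasurableSpace α] {ν : Measure α} {F G : α → ℝ≥0∞}
    (hF : AEMeasurable F ν) (hG : AEMeasurable G ν) (hF2 : ∫⁻ x, F x ^ (2 : ℝ) ∂ν ≠ ∞)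
    (hG2 : ∫⁻ x, G x ^ (2 : ℝ) ∂ν ≠ ∞) : ∫⁻ x, F x * G x ∂ν ≠ ∞ := by
  have h := ENNReal.lintegral_mul_le_Lp_mul_Lq ν Real.HolderConjugate.two_two hF hG
  refine ne_top_of_le_ne_top ?_ (le_of_eq_of_le (by rfl) h)
  exact ENNReal.mul_ne_top (ENNReal.rpow_ne_top_of_nonneg (by norm_num) hF2)
    (ENNReal.rpow_ne_top_of_nonneg (by norm_num) hG2)

/-- `∫ (C F)^p = C^p ∫ F^p` bookkeeping: finiteness transfers through constants. [folklore] -/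
theorem lintegral_rpow_ne_top_of_le_const_mul {α : Type*} [MeasurableSpace α] {ν : Measure α}
    {F G : α → ℝ≥0∞} {C : ℝ≥0∞} (hC : C ≠ ∞) (hle : ∀ x, F x ≤ C * G x) {p : ℝ} (hp : 0 ≤ p)
    (hG : ∫⁻ x, G x ^ p ∂ν ≠ ∞) : ∫⁻ x, F x ^ p ∂ν ≠ ∞ := by
  refine ne_top_of_le_ne_top ?_ (lintegral_mono fun x => ENNReal.rpow_le_rpow (hle x) hp)
  simp_rw [ENNReal.mul_rpow_of_nonneg _ _ hp]
  rw [lintegral_const_mul' _ _ (ENNReal.rpow_ne_top_of_nonneg hp hC)]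
  exact ENNReal.mul_ne_top (ENNReal.rpow_ne_top_of_nonneg hp hC) hG

/-- The a.e. version of the previous lemma. [folklore] -/
theorem lintegral_rpow_ne_top_of_ae_le_const_mul {α : Type*} [MeasurableSpace α] {ν : Measure α}
    {F G : α → ℝ≥0∞} {C : ℝ≥0∞} (hC : C ≠ ∞) (hle : ∀ᵐ x ∂ν, F x ≤ C * G x) {p : ℝ} (hp : 0 ≤ p)
    (hG : ∫⁻ x, G x ^ p ∂ν ≠ ∞) : ∫⁻ x, F x ^ p ∂ν ≠ ∞ := by
  refine ne_top_of_le_ne_top ?_ (lintegral_mono_ae (hle.mono fun x hx => ENNReal.rpow_le_rpow hx hp))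
  simp_rw [ENNReal.mul_rpow_of_nonneg _ _ hp]
  rw [lintegral_const_mul' _ _ (ENNReal.rpow_ne_top_of_nonneg hp hC)]
  exact ENNReal.mul_ne_top (ENNReal.rpow_ne_top_of_nonneg hp hC) hG

/-! ### The `a`-factors -/

/-- **Pairing 1, first factor**: `a(s,x) = χ(s)ψ(x) G₁(s,x) u₃(s,x)` is a.e.-measurable and `∫ ‖a(s,·)‖_{L²(K)} ds < ∞`
(`‖G₁(s)u₃(s)‖_{L²} ≤ ‖G₁(s)‖_{L²} m(s)`, Cauchy–Schwarz in time). [folklore] -/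
theorem pairing_one_a {K : Set (EuclideanSpace ℝ (Fin 3))} (hK : IsCompact K)
    (h₁ : IsLocalLeraySolutionOn T ν u₀ u₁ p₁)
    (hG₁ : HasWeakSpatialGradientOn (slab (EuclideanSpace ℝ (Fin 3)) (Ioo 0 T) isOpen_Ioo) u₁ G₁)
    (hu₃ : AEStronglyMeasurable (uncurry u₃)
      (((volume : Measure ℝ).restrict (Ioo 0 T)).prod ((volume : Measure (EuclideanSpace ℝ (Fin 3))).restrict K)))
    (hm : ∀ᵐ t ∂((volume : Measure ℝ).restrict (Ioo 0 T)),
      eLpNorm (u₃ t) ∞ ((volume : Measure (EuclideanSpace ℝ (Fin 3))).restrict K) ≤ ‖m t‖ₑ)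
    (hm2 : IntegrableOn (fun t => m t ^ 2) (Ioo 0 T) volume)
    (hχc : Continuous χ) {Cχ : ℝ} (hχb : ∀ s, ‖χ s‖ ≤ Cχ)
    (hψc : Continuous ψ) {Cψ : ℝ} (hψb : ∀ x, ‖ψ x‖ ≤ Cψ) :
    AEStronglyMeasurable (uncurry fun s x => (χ s * ψ x) • G₁ s x (u₃ s x))
      (((volume : Measure ℝ).restrict (Ioo 0 T)).prod ((volume : Measure (EuclideanSpace ℝ (Fin 3))).restrict K)) ∧
    ∫⁻ s, eLpNorm (fun x => (χ s * ψ x) • G₁ s x (u₃ s x)) 2 ((volume : Measure (EuclideanSpace ℝ (Fin 3))).restrict K)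
      ∂((volume : Measure ℝ).restrict (Ioo 0 T)) ≠ ∞ := by
  set μI : Measure ℝ := volume.restrict (Ioo 0 T) with hμI
  set μK : Measure (EuclideanSpace ℝ (Fin 3)) := volume.restrict K with hμK
  have hG₁m := hG₁.aestronglyMeasurable_prod_restrict K
  have hw : Continuous fun z : ℝ × EuclideanSpace ℝ (Fin 3) => χ z.1 * ψ z.2 :=
    (hχc.comp continuous_fst).mul (hψc.comp continuous_snd)
  have ha : AEStronglyMeasurable (uncurry fun s x => (χ s * ψ x) • G₁ s x (u₃ s x)) (μI.prod μK) :=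
    hw.aestronglyMeasurable.smul (aestronglyMeasurable_clm_apply_fin3 hG₁m hu₃)
  refine ⟨ha, ?_⟩
  obtain ⟨hmm, hmm2⟩ := aemeasurable_enorm_and_lintegral_sq_lt_top_of_integrableOn_sq hm2
  have hCψ0 : 0 ≤ Cψ := (norm_nonneg _).trans (hψb 0)
  have hCχ0 : 0 ≤ Cχ := (norm_nonneg _).trans (hχb 0)
  -- slice bound
  have hslice : ∀ᵐ s ∂μI, eLpNorm (fun x => (χ s * ψ x) • G₁ s x (u₃ s x)) 2 μK ≤
      ENNReal.ofReal (Cχ * Cψ) * (eLpNorm (G₁ s) 2 μK * ‖m s‖ₑ) := by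
    filter_upwards [hm, hG₁m.prodMk_left, hu₃.prodMk_left] with s hms hGs hus
    have h1 : eLpNorm (fun x => (χ s * ψ x) • G₁ s x (u₃ s x)) 2 μK ≤
        ENNReal.ofReal (Cχ * Cψ) * eLpNorm (fun x => G₁ s x (u₃ s x)) 2 μK :=
      eLpNorm_smul_le_of_norm_le (fun x => by
        rw [norm_mul]; exact mul_le_mul (hχb s) (hψb x) (norm_nonneg _) hCχ0) _ 2
    have h2 : eLpNorm (fun x => G₁ s x (u₃ s x)) 2 μK ≤ eLpNorm (G₁ s) 2 μK * eLpNorm (u₃ s) ∞ μK :=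
      eLpNorm_clm_apply_le_mul_eLpNorm hGs hus 2 ∞ 2
    exact h1.trans (mul_le_mul' le_rfl (h2.trans (mul_le_mul' le_rfl hms)))
  refine ne_top_of_le_ne_top ?_ (lintegral_mono_ae hslice)
  have hmeas : AEMeasurable (fun s => eLpNorm (G₁ s) 2 μK * ‖m s‖ₑ) μI :=
    (aemeasurable_eLpNorm_slice hG₁m 2).mul hmm
  rw [lintegral_const_mul'' _ hmeas]
  refine ENNReal.mul_ne_top ENNReal.ofReal_ne_top ?_
  exact lintegral_mul_ne_top_of_sq (aemeasurable_eLpNorm_slice hG₁m 2) hmm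
    (h₁.lintegral_eLpNorm_grad_slice_lt_top hG₁ hK).ne hmm2.ne

/-- **Pairing 2, first factor**: `a = χψ G₁ (u₁ - u₃)`, with
`∫ ‖a(s,·)‖²_{L^{6/5}(K)} ds < ∞` (`‖G₁(u₁-u₃)‖_{6/5} ≤ ‖G₁‖₂ ‖u₁-u₃‖₃ ≤ ε ‖G₁‖₂`). [folklore] -/
theorem pairing_two_a {K : Set (EuclideanSpace ℝ (Fin 3))} (hK : IsCompact K)
    (h₁ : IsLocalLeraySolutionOn T ν u₀ u₁ p₁)
    (hG₁ : HasWeakSpatialGradientOn (slab (EuclideanSpace ℝ (Fin 3)) (Ioo 0 T) isOpen_Ioo) u₁ G₁)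
    (hu₃ : AEStronglyMeasurable (uncurry u₃)
      (((volume : Measure ℝ).restrict (Ioo 0 T)).prod ((volume : Measure (EuclideanSpace ℝ (Fin 3))).restrict K)))
    {ε : ℝ} (hε3 : ∀ᵐ t ∂((volume : Measure ℝ).restrict (Ioo 0 T)),
      eLpNorm (fun x => u₁ t x - u₃ t x) 3 ((volume : Measure (EuclideanSpace ℝ (Fin 3))).restrict K) ≤ ENNReal.ofReal ε)
    (hχc : Continuous χ) {Cχ : ℝ} (hχb : ∀ s, ‖χ s‖ ≤ Cχ)
    (hψc : Continuous ψ) {Cψ : ℝ} (hψb : ∀ x, ‖ψ x‖ ≤ Cψ) :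
    AEStronglyMeasurable (uncurry fun s x => (χ s * ψ x) • G₁ s x (u₁ s x - u₃ s x))
      (((volume : Measure ℝ).restrict (Ioo 0 T)).prod ((volume : Measure (EuclideanSpace ℝ (Fin 3))).restrict K)) ∧
    ∫⁻ s, eLpNorm (fun x => (χ s * ψ x) • G₁ s x (u₁ s x - u₃ s x)) (ENNReal.ofReal (6 / 5))
      ((volume : Measure (EuclideanSpace ℝ (Fin 3))).restrict K) ^ (2 : ℝ) ∂((volume : Measure ℝ).restrict (Ioo 0 T)) ≠ ∞ := by
  set μI : Measure ℝ := volume.restrict (Ioo 0 T) with hμI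
  set μK : Measure (EuclideanSpace ℝ (Fin 3)) := volume.restrict K with hμK
  haveI := holderTriple_two_three_sixFifths
  have hG₁m := hG₁.aestronglyMeasurable_prod_restrict K
  have hu₁m := h₁.aestronglyMeasurable_prod_restrict K
  have hdm : AEStronglyMeasurable (uncurry fun s x => u₁ s x - u₃ s x) (μI.prod μK) := hu₁m.sub hu₃
  have hw : Continuous fun z : ℝ × EuclideanSpace ℝ (Fin 3) => χ z.1 * ψ z.2 :=
    (hχc.comp continuous_fst).mul (hψc.comp continuous_snd)
  have ha : AEStronglyMeasurable (uncurry fun s x => (χ s * ψ x) • G₁ s x (u₁ s x - u₃ s x)) (μI.prod μK) :=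
    hw.aestronglyMeasurable.smul (aestronglyMeasurable_clm_apply_fin3 hG₁m hdm)
  refine ⟨ha, ?_⟩
  have hCψ0 : 0 ≤ Cψ := (norm_nonneg _).trans (hψb 0)
  have hCχ0 : 0 ≤ Cχ := (norm_nonneg _).trans (hχb 0)
  have hslice : ∀ᵐ s ∂μI, eLpNorm (fun x => (χ s * ψ x) • G₁ s x (u₁ s x - u₃ s x)) (ENNReal.ofReal (6 / 5)) μK ≤
      (ENNReal.ofReal (Cχ * Cψ) * ENNReal.ofReal ε) * eLpNorm (G₁ s) 2 μK := by
    filter_upwards [hε3, hG₁m.prodMk_left, hdm.prodMk_left] with s hεs hGs hds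
    have h1 : eLpNorm (fun x => (χ s * ψ x) • G₁ s x (u₁ s x - u₃ s x)) (ENNReal.ofReal (6 / 5)) μK ≤
        ENNReal.ofReal (Cχ * Cψ) * eLpNorm (fun x => G₁ s x (u₁ s x - u₃ s x)) (ENNReal.ofReal (6 / 5)) μK :=
      eLpNorm_smul_le_of_norm_le (fun x => by
        rw [norm_mul]; exact mul_le_mul (hχb s) (hψb x) (norm_nonneg _) hCχ0) _ _
    have h2 : eLpNorm (fun x => G₁ s x (u₁ s x - u₃ s x)) (ENNReal.ofReal (6 / 5)) μK ≤
        eLpNorm (G₁ s) 2 μK * eLpNorm (fun x => u₁ s x - u₃ s x) 3 μK :=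
      eLpNorm_clm_apply_le_mul_eLpNorm hGs hds 2 3 _
    calc _ ≤ ENNReal.ofReal (Cχ * Cψ) * (eLpNorm (G₁ s) 2 μK * ENNReal.ofReal ε) :=
          h1.trans (mul_le_mul' le_rfl (h2.trans (mul_le_mul' le_rfl hεs)))
      _ = _ := by ring
  exact lintegral_rpow_ne_top_of_ae_le_const_mul (ENNReal.mul_ne_top ENNReal.ofReal_ne_top ENNReal.ofReal_ne_top)
    hslice (by norm_num) (h₁.lintegral_eLpNorm_grad_slice_lt_top hG₁ hK).ne

/-- **Pairings 3 and 8, pressure factor**: `(s,x) ↦ χ(s) p(s,x) ∇ψ(x)` is a.e.-measurable,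
integrable on the cylinder, with `∫ ‖·(s)‖^{3/2}_{L^{3/2}(K)} ds < ∞`. [folklore] -/
theorem pairing_pressure_factor {K : Set (EuclideanSpace ℝ (Fin 3))} (hK : IsCompact K)
    {v : ℝ → EuclideanSpace ℝ (Fin 3) → EuclideanSpace ℝ (Fin 3)} {π : ℝ → EuclideanSpace ℝ (Fin 3) → ℝ}
    (h : IsLocalLeraySolutionOn T ν u₀ v π)
    (hχc : Continuous χ) {Cχ : ℝ} (hχb : ∀ s, ‖χ s‖ ≤ Cχ)
    (hgc : Continuous (gradient ψ)) {Cψ : ℝ} (hgb : ∀ x, ‖gradient ψ x‖ ≤ Cψ) :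
    AEStronglyMeasurable (uncurry fun s x => (χ s * π s x) • gradient ψ x)
      (((volume : Measure ℝ).restrict (Ioo 0 T)).prod ((volume : Measure (EuclideanSpace ℝ (Fin 3))).restrict K)) ∧
    Integrable (uncurry fun s x => (χ s * π s x) • gradient ψ x)
      (((volume : Measure ℝ).restrict (Ioo 0 T)).prod ((volume : Measure (EuclideanSpace ℝ (Fin 3))).restrict K)) ∧
    ∫⁻ s, eLpNorm (fun x => (χ s * π s x) • gradient ψ x) (ENNReal.ofReal (3 / 2))
      ((volume : Measure (EuclideanSpace ℝ (Fin 3))).restrict K) ^ (3 / 2 : ℝ) ∂((volume : Measure ℝ).restrict (Ioo 0 T)) ≠ ∞ := by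
  set μI : Measure ℝ := volume.restrict (Ioo 0 T) with hμI
  set μK : Measure (EuclideanSpace ℝ (Fin 3)) := volume.restrict K with hμK
  have hπm := h.aestronglyMeasurable_pressure_prod_restrict hK
  have hCψ0 : 0 ≤ Cψ := (norm_nonneg _).trans (hgb 0)
  have hCχ0 : 0 ≤ Cχ := (norm_nonneg _).trans (hχb 0)
  have ha : AEStronglyMeasurable (uncurry fun s x => (χ s * π s x) • gradient ψ x) (μI.prod μK) :=
    (((hχc.comp continuous_fst).aestronglyMeasurable).mul hπm).smul (hgc.comp continuous_snd).aestronglyMeasurable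
  have hpt : ∀ z : ℝ × EuclideanSpace ℝ (Fin 3), ‖(χ z.1 * π z.1 z.2) • gradient ψ z.2‖ ≤ (Cχ * Cψ) * ‖π z.1 z.2‖ := by
    intro z
    rw [norm_smul, norm_mul]
    calc ‖χ z.1‖ * ‖π z.1 z.2‖ * ‖gradient ψ z.2‖ ≤ Cχ * ‖π z.1 z.2‖ * Cψ :=
          mul_le_mul (mul_le_mul_of_nonneg_right (hχb _) (norm_nonneg _)) (hgb _) (norm_nonneg _)
            (mul_nonneg hCχ0 (norm_nonneg _))
      _ = (Cχ * Cψ) * ‖π z.1 z.2‖ := by ring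
  have hπi : Integrable (uncurry π) (μI.prod μK) := by
    rw [hμI, hμK, prod_restrict_eq_restrict_cylinder]; exact h.integrableOn_pressure hK
  refine ⟨ha, Integrable.mono' (hπi.norm.const_mul (Cχ * Cψ)) ha (Eventually.of_forall fun z => hpt z), ?_⟩
  have hslice : ∀ s, eLpNorm (fun x => (χ s * π s x) • gradient ψ x) (ENNReal.ofReal (3 / 2)) μK ≤
      ENNReal.ofReal (Cχ * Cψ) * eLpNorm (π s) (ENNReal.ofReal (3 / 2)) μK := fun s =>
    eLpNorm_le_mul_eLpNorm_of_ae_le_mul (Eventually.of_forall fun x => hpt (s, x)) _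
  exact lintegral_rpow_ne_top_of_le_const_mul ENNReal.ofReal_ne_top hslice (by norm_num)
    (h.lintegral_eLpNorm_pressure_slice_lt_top hK).ne

/-- **Pairings 4, 5, 9, gradient factors**: for a bounded continuous vector field `c` on `ℝ³`,
`(s,x) ↦ χ(s) G(s,x) c(x)` is a.e.-measurable and integrable on the cylinder, with `∫ ‖·(s)‖²_{L²(K)} ds < ∞`
(any continuous bounded time weight `χ`, e.g. `χ ≡ 1`). [folklore] -/
theorem pairing_gradient_factor {K : Set (EuclideanSpace ℝ (Fin 3))} (hK : IsCompact K)
    {v : ℝ → EuclideanSpace ℝ (Fin 3) → EuclideanSpace ℝ (Fin 3)} {π : ℝ → EuclideanSpace ℝ (Fin 3) → ℝ}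
    {G : ℝ → EuclideanSpace ℝ (Fin 3) → EuclideanSpace ℝ (Fin 3) →L[ℝ] EuclideanSpace ℝ (Fin 3)}
    (h : IsLocalLeraySolutionOn T ν u₀ v π)
    (hG : HasWeakSpatialGradientOn (slab (EuclideanSpace ℝ (Fin 3)) (Ioo 0 T) isOpen_Ioo) v G)
    (hχc : Continuous χ) {Cχ : ℝ} (hχb : ∀ s, ‖χ s‖ ≤ Cχ)
    {c : EuclideanSpace ℝ (Fin 3) → EuclideanSpace ℝ (Fin 3)} (hcc : Continuous c) {Cc : ℝ} (hcb : ∀ x, ‖c x‖ ≤ Cc) :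
    AEStronglyMeasurable (uncurry fun s x => χ s • G s x (c x))
      (((volume : Measure ℝ).restrict (Ioo 0 T)).prod ((volume : Measure (EuclideanSpace ℝ (Fin 3))).restrict K)) ∧
    Integrable (uncurry fun s x => χ s • G s x (c x))
      (((volume : Measure ℝ).restrict (Ioo 0 T)).prod ((volume : Measure (EuclideanSpace ℝ (Fin 3))).restrict K)) ∧
    ∫⁻ s, eLpNorm (fun x => χ s • G s x (c x)) 2 ((volume : Measure (EuclideanSpace ℝ (Fin 3))).restrict K) ^ (2 : ℝ)
      ∂((volume : Measure ℝ).restrict (Ioo 0 T)) ≠ ∞ := by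
  set μI : Measure ℝ := volume.restrict (Ioo 0 T) with hμI
  set μK : Measure (EuclideanSpace ℝ (Fin 3)) := volume.restrict K with hμK
  have hGm := hG.aestronglyMeasurable_prod_restrict K
  have hCc0 : 0 ≤ Cc := (norm_nonneg _).trans (hcb 0)
  have hCχ0 : 0 ≤ Cχ := (norm_nonneg _).trans (hχb 0)
  have ha : AEStronglyMeasurable (uncurry fun s x => χ s • G s x (c x)) (μI.prod μK) :=
    ((hχc.comp continuous_fst).aestronglyMeasurable).smul
      (aestronglyMeasurable_clm_apply_fin3 hGm (hcc.comp continuous_snd).aestronglyMeasurable)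
  have hpt : ∀ s x, ‖χ s • G s x (c x)‖ ≤ (Cχ * Cc) * ‖G s x‖ := by
    intro s x
    rw [norm_smul]
    calc ‖χ s‖ * ‖G s x (c x)‖ ≤ Cχ * (‖G s x‖ * Cc) :=
          mul_le_mul (hχb s) ((ContinuousLinearMap.le_opNorm _ _).trans
            (mul_le_mul_of_nonneg_left (hcb x) (norm_nonneg _))) (norm_nonneg _) hCχ0
      _ = (Cχ * Cc) * ‖G s x‖ := by ring
  have hslice : ∀ s, eLpNorm (fun x => χ s • G s x (c x)) 2 μK ≤ ENNReal.ofReal (Cχ * Cc) * eLpNorm (G s) 2 μK :=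
    fun s => eLpNorm_le_mul_eLpNorm_of_ae_le_mul (Eventually.of_forall fun x => hpt s x) _
  have h2 : ∫⁻ s, eLpNorm (fun x => χ s • G s x (c x)) 2 μK ^ (2 : ℝ) ∂μI ≠ ∞ :=
    lintegral_rpow_ne_top_of_le_const_mul ENNReal.ofReal_ne_top hslice (by norm_num)
      (h.lintegral_eLpNorm_grad_slice_lt_top hG hK).ne
  exact ⟨ha, integrable_of_lintegral_eLpNorm_slice_two hK ha h2, h2⟩

/-- **Pairings 6 and 7, first factor**: `a(s,x) = θ(s) G₂(s,x) u₂(s,x)` is a.e.-measurable, with `∫ ‖a(s,·)‖²_{L¹(K)} ds < ∞` (`‖G₂u₂‖₁ ≤ ‖G₂‖₂‖u₂‖₂`, `u₂` bounded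
in `L²(K)`) and `∫ ‖a(s,·)‖_{L^{3/2}(K)} ds < ∞` (`‖G₂u₂‖_{3/2} ≤ ‖G₂‖₂‖u₂‖₆`, Cauchy–Schwarz in
time). [folklore] -/
theorem pairing_six_seven_a {K : Set (EuclideanSpace ℝ (Fin 3))} (hK : IsCompact K)
    (h₂ : IsLocalLeraySolutionOn T ν u₀ u₂ p₂)
    (hG₂ : HasWeakSpatialGradientOn (slab (EuclideanSpace ℝ (Fin 3)) (Ioo 0 T) isOpen_Ioo) u₂ G₂)
    (hθc : Continuous θ) {Cθ : ℝ} (hθb : ∀ s, ‖θ s‖ ≤ Cθ) :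
    AEStronglyMeasurable (uncurry fun s x => θ s • G₂ s x (u₂ s x))
      (((volume : Measure ℝ).restrict (Ioo 0 T)).prod ((volume : Measure (EuclideanSpace ℝ (Fin 3))).restrict K)) ∧
    ∫⁻ s, eLpNorm (fun x => θ s • G₂ s x (u₂ s x)) 1 ((volume : Measure (EuclideanSpace ℝ (Fin 3))).restrict K) ^ (2 : ℝ)
      ∂((volume : Measure ℝ).restrict (Ioo 0 T)) ≠ ∞ ∧
    ∫⁻ s, eLpNorm (fun x => θ s • G₂ s x (u₂ s x)) (ENNReal.ofReal (3 / 2))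
      ((volume : Measure (EuclideanSpace ℝ (Fin 3))).restrict K) ∂((volume : Measure ℝ).restrict (Ioo 0 T)) ≠ ∞ := by
  set μI : Measure ℝ := volume.restrict (Ioo 0 T) with hμI
  set μK : Measure (EuclideanSpace ℝ (Fin 3)) := volume.restrict K with hμK
  haveI : ENNReal.HolderTriple 2 6 (ENNReal.ofReal (3 / 2)) := by
    have h := holderTriple_ofReal (a := 2) (b := 6) (c := 3 / 2) (by norm_num) (by norm_num) (by norm_num)
      (by norm_num)
    simpa using h
  have hG₂m := hG₂.aestronglyMeasurable_prod_restrict K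
  have hu₂m := h₂.aestronglyMeasurable_prod_restrict K
  have hCθ0 : 0 ≤ Cθ := (norm_nonneg _).trans (hθb 0)
  have ha : AEStronglyMeasurable (uncurry fun s x => θ s • G₂ s x (u₂ s x)) (μI.prod μK) :=
    ((hθc.comp continuous_fst).aestronglyMeasurable).smul (aestronglyMeasurable_clm_apply_fin3 hG₂m hu₂m)
  refine ⟨ha, ?_, ?_⟩
  · obtain ⟨Cb, hCb, hbB⟩ := h₂.exists_ae_eLpNorm_slice_two_le hK
    have hslice : ∀ᵐ s ∂μI, eLpNorm (fun x => θ s • G₂ s x (u₂ s x)) 1 μK ≤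
        (ENNReal.ofReal Cθ * Cb) * eLpNorm (G₂ s) 2 μK := by
      filter_upwards [hbB, hG₂m.prodMk_left, hu₂m.prodMk_left] with s hbs hGs hus
      have h1 : eLpNorm (fun x => θ s • G₂ s x (u₂ s x)) 1 μK ≤
          ENNReal.ofReal Cθ * eLpNorm (fun x => G₂ s x (u₂ s x)) 1 μK :=
        eLpNorm_smul_le_of_norm_le (fun _ => hθb s) _ 1
      have h2 : eLpNorm (fun x => G₂ s x (u₂ s x)) 1 μK ≤ eLpNorm (G₂ s) 2 μK * eLpNorm (u₂ s) 2 μK :=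
        eLpNorm_clm_apply_le_mul_eLpNorm hGs hus 2 2 1
      calc _ ≤ ENNReal.ofReal Cθ * (eLpNorm (G₂ s) 2 μK * Cb) :=
            h1.trans (mul_le_mul' le_rfl (h2.trans (mul_le_mul' le_rfl hbs)))
        _ = _ := by ring
    exact lintegral_rpow_ne_top_of_ae_le_const_mul (ENNReal.mul_ne_top ENNReal.ofReal_ne_top hCb)
      hslice (by norm_num) (h₂.lintegral_eLpNorm_grad_slice_lt_top hG₂ hK).ne
  · have hslice : ∀ᵐ s ∂μI, eLpNorm (fun x => θ s • G₂ s x (u₂ s x)) (ENNReal.ofReal (3 / 2)) μK ≤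
        ENNReal.ofReal Cθ * (eLpNorm (G₂ s) 2 μK * eLpNorm (u₂ s) 6 μK) := by
      filter_upwards [hG₂m.prodMk_left, hu₂m.prodMk_left] with s hGs hus
      have h1 : eLpNorm (fun x => θ s • G₂ s x (u₂ s x)) (ENNReal.ofReal (3 / 2)) μK ≤
          ENNReal.ofReal Cθ * eLpNorm (fun x => G₂ s x (u₂ s x)) (ENNReal.ofReal (3 / 2)) μK :=
        eLpNorm_smul_le_of_norm_le (fun _ => hθb s) _ _
      exact h1.trans (mul_le_mul' le_rfl (eLpNorm_clm_apply_le_mul_eLpNorm hGs hus 2 6 _))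
    refine ne_top_of_le_ne_top ?_ (lintegral_mono_ae hslice)
    have hmeas : AEMeasurable (fun s => eLpNorm (G₂ s) 2 μK * eLpNorm (u₂ s) 6 μK) μI :=
      (aemeasurable_eLpNorm_slice hG₂m 2).mul (aemeasurable_eLpNorm_slice hu₂m 6)
    rw [lintegral_const_mul'' _ hmeas]
    refine ENNReal.mul_ne_top ENNReal.ofReal_ne_top ?_
    exact lintegral_mul_ne_top_of_sq (aemeasurable_eLpNorm_slice hG₂m 2) (aemeasurable_eLpNorm_slice hu₂m 6)
      (h₂.lintegral_eLpNorm_grad_slice_lt_top hG₂ hK).ne (h₂.lintegral_eLpNorm_slice_six_sq_lt_top hG₂ hK).ne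

/-- **Pairings 8 and 9, velocity factor**: `a(s,x) = χ(s) u₁(s,x)` is a.e.-measurable, with `∫ ‖a(s)‖³_{L³(K)} < ∞` and `∫ ‖a(s)‖²_{L²(K)} < ∞`. [folklore] -/
theorem pairing_velocity_a {K : Set (EuclideanSpace ℝ (Fin 3))} (hK : IsCompact K)
    (h₁ : IsLocalLeraySolutionOn T ν u₀ u₁ p₁)
    (hχc : Continuous χ) {Cχ : ℝ} (hχb : ∀ s, ‖χ s‖ ≤ Cχ) :
    AEStronglyMeasurable (uncurry fun s x => χ s • u₁ s x)
      (((volume : Measure ℝ).restrict (Ioo 0 T)).prod ((volume : Measure (EuclideanSpace ℝ (Fin 3))).restrict K)) ∧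
    ∫⁻ s, eLpNorm (fun x => χ s • u₁ s x) 3 ((volume : Measure (EuclideanSpace ℝ (Fin 3))).restrict K) ^ (3 : ℝ)
      ∂((volume : Measure ℝ).restrict (Ioo 0 T)) ≠ ∞ ∧
    ∫⁻ s, eLpNorm (fun x => χ s • u₁ s x) 2 ((volume : Measure (EuclideanSpace ℝ (Fin 3))).restrict K) ^ (2 : ℝ)
      ∂((volume : Measure ℝ).restrict (Ioo 0 T)) ≠ ∞ := by
  set μI : Measure ℝ := volume.restrict (Ioo 0 T) with hμI
  set μK : Measure (EuclideanSpace ℝ (Fin 3)) := volume.restrict K with hμK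
  have hu₁m := h₁.aestronglyMeasurable_prod_restrict K
  have ha : AEStronglyMeasurable (uncurry fun s x => χ s • u₁ s x) (μI.prod μK) :=
    ((hχc.comp continuous_fst).aestronglyMeasurable).smul hu₁m
  have hslice : ∀ (q : ℝ≥0∞) s, eLpNorm (fun x => χ s • u₁ s x) q μK ≤ ENNReal.ofReal Cχ * eLpNorm (u₁ s) q μK :=
    fun q s => eLpNorm_smul_le_of_norm_le (fun _ => hχb s) _ q
  refine ⟨ha, ?_, ?_⟩
  · exact lintegral_rpow_ne_top_of_le_const_mul ENNReal.ofReal_ne_top (hslice 3) (by norm_num)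
      (h₁.lintegral_eLpNorm_slice_three_lt_top hK).ne
  · exact lintegral_rpow_ne_top_of_le_const_mul ENNReal.ofReal_ne_top (hslice 2) (by norm_num)
      (h₁.lintegral_eLpNorm_slice_two_lt_top hK).ne

/-! ### The `b`-factors of pairings 6 and 7 -/

/-- **Pairing 6, second factor**: `b(σ,x) = χ(σ) ψ(x) u₃(σ,x)` is a.e.-measurable, integrable on
the cylinder (`u₃ = u₁ - (u₁ - u₃)`), and `∫ ‖b(σ)‖²_{L^∞(K)} dσ ≤ C ∫ m² < ∞`. [folklore] -/
theorem pairing_six_b {K : Set (EuclideanSpace ℝ (Fin 3))} (hK : IsCompact K)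
    (h₁ : IsLocalLeraySolutionOn T ν u₀ u₁ p₁)
    (hu₃ : AEStronglyMeasurable (uncurry u₃)
      (((volume : Measure ℝ).restrict (Ioo 0 T)).prod ((volume : Measure (EuclideanSpace ℝ (Fin 3))).restrict K)))
    (hm : ∀ᵐ t ∂((volume : Measure ℝ).restrict (Ioo 0 T)),
      eLpNorm (u₃ t) ∞ ((volume : Measure (EuclideanSpace ℝ (Fin 3))).restrict K) ≤ ‖m t‖ₑ)
    (hm2 : IntegrableOn (fun t => m t ^ 2) (Ioo 0 T) volume)
    {ε : ℝ} (hε3 : ∀ᵐ t ∂((volume : Measure ℝ).restrict (Ioo 0 T)),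
      eLpNorm (fun x => u₁ t x - u₃ t x) 3 ((volume : Measure (EuclideanSpace ℝ (Fin 3))).restrict K) ≤ ENNReal.ofReal ε)
    (hχc : Continuous χ) {Cχ : ℝ} (hχb : ∀ s, ‖χ s‖ ≤ Cχ)
    (hψc : Continuous ψ) {Cψ : ℝ} (hψb : ∀ x, ‖ψ x‖ ≤ Cψ) :
    AEStronglyMeasurable (uncurry fun σ x => χ σ • (ψ x • u₃ σ x))
      (((volume : Measure ℝ).restrict (Ioo 0 T)).prod ((volume : Measure (EuclideanSpace ℝ (Fin 3))).restrict K)) ∧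
    Integrable (uncurry fun σ x => χ σ • (ψ x • u₃ σ x))
      (((volume : Measure ℝ).restrict (Ioo 0 T)).prod ((volume : Measure (EuclideanSpace ℝ (Fin 3))).restrict K)) ∧
    ∫⁻ σ, eLpNorm (fun x => χ σ • (ψ x • u₃ σ x)) ∞ ((volume : Measure (EuclideanSpace ℝ (Fin 3))).restrict K) ^ (2 : ℝ)
      ∂((volume : Measure ℝ).restrict (Ioo 0 T)) ≠ ∞ := by
  set μI : Measure ℝ := volume.restrict (Ioo 0 T) with hμI
  set μK : Measure (EuclideanSpace ℝ (Fin 3)) := volume.restrict K with hμK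
  have hu₁m := h₁.aestronglyMeasurable_prod_restrict K
  have hCψ0 : 0 ≤ Cψ := (norm_nonneg _).trans (hψb 0)
  have hCχ0 : 0 ≤ Cχ := (norm_nonneg _).trans (hχb 0)
  have hw : Continuous fun z : ℝ × EuclideanSpace ℝ (Fin 3) => χ z.1 * ψ z.2 :=
    (hχc.comp continuous_fst).mul (hψc.comp continuous_snd)
  have heq : (uncurry fun σ x => χ σ • (ψ x • u₃ σ x)) =
      fun z : ℝ × EuclideanSpace ℝ (Fin 3) => (χ z.1 * ψ z.2) • uncurry u₃ z := by
    funext z; simp [uncurry, mul_smul]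
  have ha : AEStronglyMeasurable (uncurry fun σ x => χ σ • (ψ x • u₃ σ x)) (μI.prod μK) := by
    rw [heq]; exact hw.aestronglyMeasurable.smul hu₃
  refine ⟨ha, ?_, ?_⟩
  · -- integrability: `u₃ = u₁ - (u₁ - u₃)`
    have hi3 : Integrable (uncurry u₃) (μI.prod μK) := by
      have h := (h₁.integrable_prod_restrict hK).sub (integrable_sub_of_ae_eLpNorm_three_le hK hu₁m hu₃ hε3)
      refine h.congr (Eventually.of_forall fun z => ?_)
      simp [uncurry]
    rw [heq]
    exact hi3.bdd_smul (Cχ * Cψ) hw.aestronglyMeasurable (Eventually.of_forall fun z => by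
      rw [norm_mul]; exact mul_le_mul (hχb _) (hψb _) (norm_nonneg _) hCχ0)
  · obtain ⟨hmm, hmm2⟩ := aemeasurable_enorm_and_lintegral_sq_lt_top_of_integrableOn_sq hm2
    have hslice : ∀ᵐ σ ∂μI, eLpNorm (fun x => χ σ • (ψ x • u₃ σ x)) ∞ μK ≤ ENNReal.ofReal (Cχ * Cψ) * ‖m σ‖ₑ := by
      filter_upwards [hm] with σ hσ
      have h1 : eLpNorm (fun x => χ σ • (ψ x • u₃ σ x)) ∞ μK ≤ ENNReal.ofReal (Cχ * Cψ) * eLpNorm (u₃ σ) ∞ μK :=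
        eLpNorm_le_mul_eLpNorm_of_ae_le_mul (Eventually.of_forall fun x => by
          rw [norm_smul, norm_smul, ← mul_assoc]
          exact mul_le_mul_of_nonneg_right (mul_le_mul (hχb σ) (hψb x) (norm_nonneg _) hCχ0) (norm_nonneg _)) _
      exact h1.trans (mul_le_mul' le_rfl hσ)
    exact lintegral_rpow_ne_top_of_ae_le_const_mul ENNReal.ofReal_ne_top hslice (by norm_num) hmm2.ne

/-- **Pairing 7, second factor**: `b(σ,x) = χ(σ) ψ(x) (u₁ - u₃)(σ,x)` is a.e.-measurable,
integrable on the cylinder, and `‖b(σ)‖_{L³(K)} ≤ C_χ C_ψ ε` for a.e. `σ`. [folklore] -/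
theorem pairing_seven_b {K : Set (EuclideanSpace ℝ (Fin 3))} (hK : IsCompact K)
    (h₁ : IsLocalLeraySolutionOn T ν u₀ u₁ p₁)
    (hu₃ : AEStronglyMeasurable (uncurry u₃)
      (((volume : Measure ℝ).restrict (Ioo 0 T)).prod ((volume : Measure (EuclideanSpace ℝ (Fin 3))).restrict K)))
    {ε : ℝ} (hε3 : ∀ᵐ t ∂((volume : Measure ℝ).restrict (Ioo 0 T)),
      eLpNorm (fun x => u₁ t x - u₃ t x) 3 ((volume : Measure (EuclideanSpace ℝ (Fin 3))).restrict K) ≤ ENNReal.ofReal ε)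
    (hχc : Continuous χ) {Cχ : ℝ} (hχb : ∀ s, ‖χ s‖ ≤ Cχ)
    (hψc : Continuous ψ) {Cψ : ℝ} (hψb : ∀ x, ‖ψ x‖ ≤ Cψ) :
    AEStronglyMeasurable (uncurry fun σ x => χ σ • (ψ x • (u₁ σ x - u₃ σ x)))
      (((volume : Measure ℝ).restrict (Ioo 0 T)).prod ((volume : Measure (EuclideanSpace ℝ (Fin 3))).restrict K)) ∧
    Integrable (uncurry fun σ x => χ σ • (ψ x • (u₁ σ x - u₃ σ x)))
      (((volume : Measure ℝ).restrict (Ioo 0 T)).prod ((volume : Measure (EuclideanSpace ℝ (Fin 3))).restrict K)) ∧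
    ∀ᵐ σ ∂((volume : Measure ℝ).restrict (Ioo 0 T)),
      eLpNorm (fun x => χ σ • (ψ x • (u₁ σ x - u₃ σ x))) 3 ((volume : Measure (EuclideanSpace ℝ (Fin 3))).restrict K) ≤
        ENNReal.ofReal (Cχ * Cψ) * ENNReal.ofReal ε := by
  set μI : Measure ℝ := volume.restrict (Ioo 0 T) with hμI
  set μK : Measure (EuclideanSpace ℝ (Fin 3)) := volume.restrict K with hμK
  have hu₁m := h₁.aestronglyMeasurable_prod_restrict K
  have hCψ0 : 0 ≤ Cψ := (norm_nonneg _).trans (hψb 0)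
  have hCχ0 : 0 ≤ Cχ := (norm_nonneg _).trans (hχb 0)
  have hw : Continuous fun z : ℝ × EuclideanSpace ℝ (Fin 3) => χ z.1 * ψ z.2 :=
    (hχc.comp continuous_fst).mul (hψc.comp continuous_snd)
  have hdi := integrable_sub_of_ae_eLpNorm_three_le hK hu₁m hu₃ hε3
  have heq : (uncurry fun σ x => χ σ • (ψ x • (u₁ σ x - u₃ σ x))) =
      fun z : ℝ × EuclideanSpace ℝ (Fin 3) => (χ z.1 * ψ z.2) • uncurry (fun t x => u₁ t x - u₃ t x) z := by
    funext z; simp [uncurry, mul_smul]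
  have ha : AEStronglyMeasurable (uncurry fun σ x => χ σ • (ψ x • (u₁ σ x - u₃ σ x))) (μI.prod μK) := by
    rw [heq]; exact hw.aestronglyMeasurable.smul hdi.aestronglyMeasurable
  refine ⟨ha, ?_, ?_⟩
  · rw [heq]
    exact hdi.bdd_smul (Cχ * Cψ) hw.aestronglyMeasurable (Eventually.of_forall fun z => by
      rw [norm_mul]; exact mul_le_mul (hχb _) (hψb _) (norm_nonneg _) hCχ0)
  · filter_upwards [hε3] with σ hσ
    have h1 : eLpNorm (fun x => χ σ • (ψ x • (u₁ σ x - u₃ σ x))) 3 μK ≤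
        ENNReal.ofReal (Cχ * Cψ) * eLpNorm (fun x => u₁ σ x - u₃ σ x) 3 μK :=
      eLpNorm_le_mul_eLpNorm_of_ae_le_mul (Eventually.of_forall fun x => by
        rw [norm_smul, norm_smul, ← mul_assoc]
        exact mul_le_mul_of_nonneg_right (mul_le_mul (hχb σ) (hψb x) (norm_nonneg _) hCχ0) (norm_nonneg _)) _
    exact h1.trans (mul_le_mul' le_rfl hσ)

/-! ### Unweighted versions (for the integrability of the densities themselves) -/

/-- Pairing 1 without time weight. [folklore] -/
theorem pairing_one_a' {K : Set (EuclideanSpace ℝ (Fin 3))} (hK : IsCompact K)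
    (h₁ : IsLocalLeraySolutionOn T ν u₀ u₁ p₁)
    (hG₁ : HasWeakSpatialGradientOn (slab (EuclideanSpace ℝ (Fin 3)) (Ioo 0 T) isOpen_Ioo) u₁ G₁)
    (hu₃ : AEStronglyMeasurable (uncurry u₃)
      (((volume : Measure ℝ).restrict (Ioo 0 T)).prod ((volume : Measure (EuclideanSpace ℝ (Fin 3))).restrict K)))
    (hm : ∀ᵐ t ∂((volume : Measure ℝ).restrict (Ioo 0 T)),
      eLpNorm (u₃ t) ∞ ((volume : Measure (EuclideanSpace ℝ (Fin 3))).restrict K) ≤ ‖m t‖ₑ)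
    (hm2 : IntegrableOn (fun t => m t ^ 2) (Ioo 0 T) volume)
    (hψc : Continuous ψ) {Cψ : ℝ} (hψb : ∀ x, ‖ψ x‖ ≤ Cψ) :
    AEStronglyMeasurable (uncurry fun s x => ψ x • G₁ s x (u₃ s x))
      (((volume : Measure ℝ).restrict (Ioo 0 T)).prod ((volume : Measure (EuclideanSpace ℝ (Fin 3))).restrict K)) ∧
    ∫⁻ s, eLpNorm (fun x => ψ x • G₁ s x (u₃ s x)) 2 ((volume : Measure (EuclideanSpace ℝ (Fin 3))).restrict K)
      ∂((volume : Measure ℝ).restrict (Ioo 0 T)) ≠ ∞ := by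
  obtain ⟨ha, haN⟩ := pairing_one_a (χ := fun _ => (1 : ℝ)) hK h₁ hG₁ hu₃ hm hm2 continuous_const
    (Cχ := 1) (fun _ => by simp) hψc hψb
  simp only [one_mul] at ha haN
  exact ⟨ha, haN⟩

/-- Pairing 2 without time weight. [folklore] -/
theorem pairing_two_a' {K : Set (EuclideanSpace ℝ (Fin 3))} (hK : IsCompact K)
    (h₁ : IsLocalLeraySolutionOn T ν u₀ u₁ p₁)
    (hG₁ : HasWeakSpatialGradientOn (slab (EuclideanSpace ℝ (Fin 3)) (Ioo 0 T) isOpen_Ioo) u₁ G₁)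
    (hu₃ : AEStronglyMeasurable (uncurry u₃)
      (((volume : Measure ℝ).restrict (Ioo 0 T)).prod ((volume : Measure (EuclideanSpace ℝ (Fin 3))).restrict K)))
    {ε : ℝ} (hε3 : ∀ᵐ t ∂((volume : Measure ℝ).restrict (Ioo 0 T)),
      eLpNorm (fun x => u₁ t x - u₃ t x) 3 ((volume : Measure (EuclideanSpace ℝ (Fin 3))).restrict K) ≤ ENNReal.ofReal ε)
    (hψc : Continuous ψ) {Cψ : ℝ} (hψb : ∀ x, ‖ψ x‖ ≤ Cψ) :
    AEStronglyMeasurable (uncurry fun s x => ψ x • G₁ s x (u₁ s x - u₃ s x))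
      (((volume : Measure ℝ).restrict (Ioo 0 T)).prod ((volume : Measure (EuclideanSpace ℝ (Fin 3))).restrict K)) ∧
    ∫⁻ s, eLpNorm (fun x => ψ x • G₁ s x (u₁ s x - u₃ s x)) (ENNReal.ofReal (6 / 5))
      ((volume : Measure (EuclideanSpace ℝ (Fin 3))).restrict K) ^ (2 : ℝ) ∂((volume : Measure ℝ).restrict (Ioo 0 T)) ≠ ∞ := by
  obtain ⟨ha, haN⟩ := pairing_two_a (χ := fun _ => (1 : ℝ)) hK h₁ hG₁ hu₃ hε3 continuous_const
    (Cχ := 1) (fun _ => by simp) hψc hψb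
  simp only [one_mul] at ha haN
  exact ⟨ha, haN⟩

/-- The pressure factor without time weight. [folklore] -/
theorem pairing_pressure_factor' {K : Set (EuclideanSpace ℝ (Fin 3))} (hK : IsCompact K)
    {v : ℝ → EuclideanSpace ℝ (Fin 3) → EuclideanSpace ℝ (Fin 3)} {π : ℝ → EuclideanSpace ℝ (Fin 3) → ℝ}
    (h : IsLocalLeraySolutionOn T ν u₀ v π)
    (hgc : Continuous (gradient ψ)) {Cψ : ℝ} (hgb : ∀ x, ‖gradient ψ x‖ ≤ Cψ) :
    AEStronglyMeasurable (uncurry fun s x => π s x • gradient ψ x)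
      (((volume : Measure ℝ).restrict (Ioo 0 T)).prod ((volume : Measure (EuclideanSpace ℝ (Fin 3))).restrict K)) ∧
    Integrable (uncurry fun s x => π s x • gradient ψ x)
      (((volume : Measure ℝ).restrict (Ioo 0 T)).prod ((volume : Measure (EuclideanSpace ℝ (Fin 3))).restrict K)) ∧
    ∫⁻ s, eLpNorm (fun x => π s x • gradient ψ x) (ENNReal.ofReal (3 / 2))
      ((volume : Measure (EuclideanSpace ℝ (Fin 3))).restrict K) ^ (3 / 2 : ℝ) ∂((volume : Measure ℝ).restrict (Ioo 0 T)) ≠ ∞ := by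
  obtain ⟨ha, hai, haN⟩ := pairing_pressure_factor (χ := fun _ => (1 : ℝ)) hK h continuous_const
    (Cχ := 1) (fun _ => by simp) hgc hgb
  simp only [one_mul] at ha hai haN
  exact ⟨ha, hai, haN⟩

/-- The gradient factors without time weight. [folklore] -/
theorem pairing_gradient_factor' {K : Set (EuclideanSpace ℝ (Fin 3))} (hK : IsCompact K)
    {v : ℝ → EuclideanSpace ℝ (Fin 3) → EuclideanSpace ℝ (Fin 3)} {π : ℝ → EuclideanSpace ℝ (Fin 3) → ℝ}
    {G : ℝ → EuclideanSpace ℝ (Fin 3) → EuclideanSpace ℝ (Fin 3) →L[ℝ] EuclideanSpace ℝ (Fin 3)}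
    (h : IsLocalLeraySolutionOn T ν u₀ v π)
    (hG : HasWeakSpatialGradientOn (slab (EuclideanSpace ℝ (Fin 3)) (Ioo 0 T) isOpen_Ioo) v G)
    {c : EuclideanSpace ℝ (Fin 3) → EuclideanSpace ℝ (Fin 3)} (hcc : Continuous c) {Cc : ℝ} (hcb : ∀ x, ‖c x‖ ≤ Cc) :
    AEStronglyMeasurable (uncurry fun s x => G s x (c x))
      (((volume : Measure ℝ).restrict (Ioo 0 T)).prod ((volume : Measure (EuclideanSpace ℝ (Fin 3))).restrict K)) ∧
    Integrable (uncurry fun s x => G s x (c x))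
      (((volume : Measure ℝ).restrict (Ioo 0 T)).prod ((volume : Measure (EuclideanSpace ℝ (Fin 3))).restrict K)) ∧
    ∫⁻ s, eLpNorm (fun x => G s x (c x)) 2 ((volume : Measure (EuclideanSpace ℝ (Fin 3))).restrict K) ^ (2 : ℝ)
      ∂((volume : Measure ℝ).restrict (Ioo 0 T)) ≠ ∞ := by
  obtain ⟨ha, hai, haN⟩ := pairing_gradient_factor (χ := fun _ => (1 : ℝ)) hK h hG continuous_const
    (Cχ := 1) (fun _ => by simp) hcc hcb
  simp only [one_smul] at ha hai haN
  exact ⟨ha, hai, haN⟩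

/-- Pairings 6–7 first factor without time weight. [folklore] -/
theorem pairing_six_seven_a' {K : Set (EuclideanSpace ℝ (Fin 3))} (hK : IsCompact K)
    (h₂ : IsLocalLeraySolutionOn T ν u₀ u₂ p₂)
    (hG₂ : HasWeakSpatialGradientOn (slab (EuclideanSpace ℝ (Fin 3)) (Ioo 0 T) isOpen_Ioo) u₂ G₂) :
    AEStronglyMeasurable (uncurry fun s x => G₂ s x (u₂ s x))
      (((volume : Measure ℝ).restrict (Ioo 0 T)).prod ((volume : Measure (EuclideanSpace ℝ (Fin 3))).restrict K)) ∧
    ∫⁻ s, eLpNorm (fun x => G₂ s x (u₂ s x)) 1 ((volume : Measure (EuclideanSpace ℝ (Fin 3))).restrict K) ^ (2 : ℝ)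
      ∂((volume : Measure ℝ).restrict (Ioo 0 T)) ≠ ∞ ∧
    ∫⁻ s, eLpNorm (fun x => G₂ s x (u₂ s x)) (ENNReal.ofReal (3 / 2))
      ((volume : Measure (EuclideanSpace ℝ (Fin 3))).restrict K) ∂((volume : Measure ℝ).restrict (Ioo 0 T)) ≠ ∞ := by
  obtain ⟨ha, haN, haN'⟩ := pairing_six_seven_a (θ := fun _ => (1 : ℝ)) hK h₂ hG₂ continuous_const
    (Cθ := 1) (fun _ => by simp)
  simp only [one_smul] at ha haN haN'
  exact ⟨ha, haN, haN'⟩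

end Pairings

end Literature.Analysis.FluidPDE
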